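import Mathlib
import HarnessLib
import Literature.MathematicalPhysics.QuantumLattice.TorusCooperSumFermiLevel
import Literature.MathematicalPhysics.QuantumLattice.TorusBandIntegratedDensity
import Summits.HubbardSuperconductivity.HubbardSuperconductivity.Theorems.WeakCouplingBCSWcbcsBcsConstructionFreeLevelCountsRows

/-!
# Crux `WcbcsBcsConstruction` (stmt-HubbardSuperconductivity-2010), line `ladder-scale-certified-chain`:
# stub (D1b) `stub_freeLevelCountsWindow` — free level counts at the two ends of the density window

For all large `L`, the free level counts `torusLevelCount L E = #{k ∈ (ℤ/Lℤ)² : ε_L(k) ≤ E}` of the torus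
band `ε_L(k) = -2(cos(2πk₀/L) + cos(2πk₁/L))` satisfy `2·#{ε_L ≤ -9/25} ≥ 0.79·L²` and
`2·#{ε_L ≤ -79/100} ≤ 0.71·L²` (registered signature `stub_freeLevelCountsWindow`; the free-gas input of the
density brackets of stub (D1c)). PROOF: by the tree's Weyl law (`tendsto_torusLevelCount_div_sq`) it suffices
to certify `N(-9/25) > 79/200` and `N(-79/100) < 71/200` for the integrated density of states
`N(E) = vol {v ∈ [0,1)² | -2(cos 2πv₀ + cos 2πv₁) ≤ E}` (numerically `0.4125`, `0.3395`). These follow from the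
staircase bounds of part 1 (`…FreeLevelCountsRows.lean`) on `60` uniform rows with two explicit tables of
box widths (units `10⁻⁴`, folded by the symmetry `j ↦ 59 - j`): the `120` row inequalities are checked in
exact rational arithmetic by `decide` (kernel) against the certified rational polynomial cosine bounds
`cos_two_pi_mul_le_ratPoly`, `ratPoly_le_cos_two_pi_mul` (Taylor polynomial of degree `14`, remainder
`2t¹⁶/16!` from Mathlib's `Complex.exp_bound'`, brackets `3.141592 < π < 3.141593`), giving
`N(-79/100) ≤ 105438/300000 = 0.35146` and `N(-9/25) ≥ 119784/300000 = 0.39928`.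
References: Weyl law / lattice-point counting (folklore); band convention Benfatto–Giuliani–Mastropietro,
AHP 7 (2006) 809, eq. (1.4).
-/

noncomputable section

-- the tree's namespace `Summit.<Summit>.<Problem>.Theorems` repeats the summit name by design (D-0017)
set_option linter.dupNamespace false

namespace Summit.HubbardSuperconductivity.HubbardSuperconductivity.Theorems

open MeasureTheory Finset Filter Topology Complex
open Literature.MathematicalPhysics.QuantumLattice Literature.Probability.LatticeModels

/-! ### A Taylor enclosure of the cosine of order 16 -/

/-- Even/odd splitting of the Taylor partial sum of `exp (x I)` of even length. [folklore] -/
theorem sum_range_two_mul_exp_taylor (x : ℝ) (n : ℕ) :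
    ∑ m ∈ range (2 * n), ((x : ℂ) * I) ^ m / (m.factorial : ℂ) =
      ((∑ k ∈ range n, (-1) ^ k * x ^ (2 * k) / ((2 * k).factorial : ℝ) : ℝ) : ℂ) +
      ((∑ k ∈ range n, (-1) ^ k * x ^ (2 * k + 1) / ((2 * k + 1).factorial : ℝ) : ℝ) : ℂ) * I := by
  induction n with
  | zero => simp
  | succ n ih =>
    rw [Nat.mul_succ, Finset.sum_range_succ, Finset.sum_range_succ, ih, Finset.sum_range_succ,
      Finset.sum_range_succ]
    have h1 : ((x : ℂ) * I) ^ (2 * n) = (((-1) ^ n * x ^ (2 * n) : ℝ) : ℂ) := by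
      rw [mul_pow, pow_mul, pow_mul, I_sq]; push_cast; ring
    have h2 : ((x : ℂ) * I) ^ (2 * n + 1) = (((-1) ^ n * x ^ (2 * n + 1) : ℝ) : ℂ) * I := by
      rw [pow_succ, h1]; push_cast; ring
    rw [h1, h2]; push_cast; ring

/-- **Taylor enclosure of the real cosine** of even order `2n` on `|x| ≤ n + 1/2`:
`|cos x - Σ_{k<n} (-1)ᵏ x²ᵏ/(2k)!| ≤ 2|x|²ⁿ/(2n)!` (real part of Mathlib's `Complex.exp_bound'`).
[folklore] -/
theorem abs_cos_sub_taylor_le {x : ℝ} {n : ℕ} (hx : |x| / (2 * n + 1) ≤ 1 / 2) :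
    |Real.cos x - ∑ k ∈ range n, (-1) ^ k * x ^ (2 * k) / ((2 * k).factorial : ℝ)| ≤
      |x| ^ (2 * n) / ((2 * n).factorial : ℝ) * 2 := by
  have hxI : ‖(x : ℂ) * I‖ = |x| := by simp
  have hb := Complex.exp_bound' (x := (x : ℂ) * I) (n := 2 * n) (by rw [hxI]; push_cast; exact hx)
  rw [sum_range_two_mul_exp_taylor, hxI] at hb
  refine le_trans ?_ hb
  have key : ∀ P Q : ℝ, Real.cos x - P = (cexp ((x : ℂ) * I) - ((P : ℂ) + (Q : ℂ) * I)).re := by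
    intro P Q
    simp only [sub_re, add_re, exp_ofReal_mul_I_re, ofReal_re, re_ofReal_mul, I_re, mul_zero,
      add_zero]
  rw [key]
  exact abs_re_le_norm _

/-- **Explicit form**: `|cos t - T₁₄(t)| ≤ 2t¹⁶/16!` for `|t| ≤ 8`, with the Taylor polynomial `T₁₄` of
degree 14 written out (remainder `≤ 8.6·10⁻⁶` at `t = π`). [folklore] -/
theorem abs_cos_sub_taylor_fourteen_le {t : ℝ} (ht : |t| ≤ 8) :
    |Real.cos t - (1 - t ^ 2 / 2 + t ^ 4 / 24 - t ^ 6 / 720 + t ^ 8 / 40320 - t ^ 10 / 3628800 +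
      t ^ 12 / 479001600 - t ^ 14 / 87178291200)| ≤ t ^ 16 / 20922789888000 * 2 := by
  have h := abs_cos_sub_taylor_le (x := t) (n := 8) (by norm_num; linarith)
  have h16 : |t| ^ (2 * 8) = t ^ 16 := by
    rw [show 2 * 8 = 16 by norm_num, ← abs_pow, abs_of_nonneg (by positivity)]
  rw [h16] at h
  have e : ∑ k ∈ range 8, (-1) ^ k * t ^ (2 * k) / ((2 * k).factorial : ℝ) =
      1 - t ^ 2 / 2 + t ^ 4 / 24 - t ^ 6 / 720 + t ^ 8 / 40320 - t ^ 10 / 3628800 +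
        t ^ 12 / 479001600 - t ^ 14 / 87178291200 := by
    simp [Finset.sum_range_succ, Nat.factorial]
    ring
  rw [e] at h
  simpa [Nat.factorial] using h

/-! ### Certified rational polynomial bounds for `cos (2πx)`, `x ∈ [0, 1/2] ∩ ℚ` -/

/-- **Certified upper bound**: for rational `x ∈ [0, 1/2]`, `cos (2πx)` is at most the rational number
`T₁₄(2·3.141592·x) + 2(2·3.141592·x)¹⁶/16!` (`cos` decreases on `[0, π]` and `3.141592 < π`). [folklore] -/
theorem cos_two_pi_mul_le_ratPoly (x : ℚ) (h0 : 0 ≤ x) (h1 : x ≤ 1 / 2) :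
    Real.cos (2 * Real.pi * x) ≤
      ((1 - (2 * 3.141592 * x) ^ 2 / 2 + (2 * 3.141592 * x) ^ 4 / 24
        - (2 * 3.141592 * x) ^ 6 / 720 + (2 * 3.141592 * x) ^ 8 / 40320
        - (2 * 3.141592 * x) ^ 10 / 3628800 + (2 * 3.141592 * x) ^ 12 / 479001600
        - (2 * 3.141592 * x) ^ 14 / 87178291200
        + (2 * 3.141592 * x) ^ 16 / 20922789888000 * 2 : ℚ) : ℝ) := by
  have h0' : (0 : ℝ) ≤ x := by exact_mod_cast h0
  have h1' : (x : ℝ) ≤ 1 / 2 := ((Rat.cast_le (K := ℝ)).2 h1).trans_eq (by norm_num)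
  have hπ := Real.pi_gt_d6
  have hπ4 := Real.pi_lt_four
  have hmono : Real.cos (2 * Real.pi * x) ≤ Real.cos (2 * 3.141592 * x) :=
    Real.cos_le_cos_of_nonneg_of_le_pi (by positivity) (by nlinarith) (by nlinarith)
  have ht : |2 * 3.141592 * (x : ℝ)| ≤ 8 := by rw [abs_of_nonneg (by positivity)]; nlinarith
  have h := abs_cos_sub_taylor_fourteen_le ht
  rw [abs_le] at h
  push_cast
  linarith

/-- **Certified lower bound**: for rational `x ∈ [0, 1/2]`, `cos (2πx)` is at least the rational number
`T₁₄(2·3.141593·x) - 2(2·3.141593·x)¹⁶/16!` if `x ≤ 0.4999` (`π < 3.141593`), and `-1` otherwise (the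
hypothesis `x ≤ 1/2` is not used; it is kept for the uniform shape of `le_volume_real_sublevelCell_of_table`).
[folklore] -/
theorem ratPoly_le_cos_two_pi_mul (x : ℚ) (h0 : 0 ≤ x) (_h1 : x ≤ 1 / 2) :
    ((if x ≤ 4999 / 10000 then
        1 - (2 * 3.141593 * x) ^ 2 / 2 + (2 * 3.141593 * x) ^ 4 / 24
          - (2 * 3.141593 * x) ^ 6 / 720 + (2 * 3.141593 * x) ^ 8 / 40320
          - (2 * 3.141593 * x) ^ 10 / 3628800 + (2 * 3.141593 * x) ^ 12 / 479001600
          - (2 * 3.141593 * x) ^ 14 / 87178291200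
          - (2 * 3.141593 * x) ^ 16 / 20922789888000 * 2
        else -1 : ℚ) : ℝ) ≤ Real.cos (2 * Real.pi * x) := by
  have h0' : (0 : ℝ) ≤ x := by exact_mod_cast h0
  split_ifs with hx
  · have hx' : (x : ℝ) ≤ 4999 / 10000 := ((Rat.cast_le (K := ℝ)).2 hx).trans_eq (by norm_num)
    have hπ := Real.pi_lt_d6
    have hπ' := Real.pi_gt_d6
    have hmono : Real.cos (2 * 3.141593 * x) ≤ Real.cos (2 * Real.pi * x) :=
      Real.cos_le_cos_of_nonneg_of_le_pi (by positivity) (by nlinarith) (by nlinarith)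
    have ht : |2 * 3.141593 * (x : ℝ)| ≤ 8 := by rw [abs_of_nonneg (by positivity)]; nlinarith
    have h := abs_cos_sub_taylor_fourteen_le ht
    rw [abs_le] at h
    push_cast
    linarith
  · push_cast
    exact Real.neg_one_le_cos _

/-! ### Staircase bounds from integer tables checked in rational arithmetic -/

/-- **Circumscribed staircase from a table.** Given a rational upper bound `ub` of `cos (2π·)` on
`[0, 1/2] ∩ ℚ` and box widths `t_j/Q ≤ 1/2` on `2K` uniform rows whose row inequalities hold for `ub`,
`N(-2m) ≤ S/(QK)` where `S = Σ_j t_j`. [folklore] -/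
theorem volume_real_sublevelCell_le_of_table {ub : ℚ → ℚ}
    (hub : ∀ x : ℚ, 0 ≤ x → x ≤ 1 / 2 → Real.cos (2 * Real.pi * x) ≤ ((ub x : ℚ) : ℝ))
    {K Q : ℕ} (hK : 0 < K) (hQ : 0 < Q) {m : ℚ} {E : ℝ} (hE : (-2 : ℝ) * m = E) (t : ℕ → ℕ) {S : ℕ}
    (hS : ∑ j ∈ range (2 * K), t j = S)
    (ht : ∀ j < 2 * K, 2 * t j ≤ Q ∧
      ub ((t j : ℚ) / Q) + ub (((min j (2 * K - 1 - j) : ℕ) : ℚ) / (2 * K : ℕ)) ≤ m) :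
    volume.real {v : Fin 2 → ℝ | (∀ i, v i ∈ Set.Ico (0 : ℝ) 1) ∧
        -2 * ∑ i : Fin 2, Real.cos (2 * Real.pi * v i) ≤ E} ≤ (S : ℝ) / (Q * K) := by
  subst hE hS
  have hKr : (0 : ℝ) < K := by exact_mod_cast hK
  have hQr : (0 : ℝ) < Q := by exact_mod_cast hQ
  have hQq : (0 : ℚ) < Q := by exact_mod_cast hQ
  have h := volume_real_sublevelCell_le_stairs (N := 2 * K) (by omega) (m := (m : ℝ))
    (fun j => (t j : ℝ) / Q) (fun j _ => by positivity) ?_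
  · refine h.trans (le_of_eq ?_)
    rw [Nat.cast_sum, Finset.sum_div]
    refine Finset.sum_congr rfl fun j _ => ?_
    push_cast
    field_simp
  · intro j hj
    obtain ⟨htj, hc⟩ := ht j hj
    have ha1 : (t j : ℚ) / Q ≤ 1 / 2 := by
      rw [div_le_iff₀ hQq]
      have : ((2 * t j : ℕ) : ℚ) ≤ Q := by exact_mod_cast htj
      push_cast at this
      linarith
    have hiK : ((min j (2 * K - 1 - j) : ℕ) : ℚ) ≤ K := by
      exact_mod_cast (by omega : min j (2 * K - 1 - j) ≤ K)
    have hy1 : ((min j (2 * K - 1 - j) : ℕ) : ℚ) / ((2 * K : ℕ) : ℚ) ≤ 1 / 2 := by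
      rw [div_le_iff₀ (by positivity), show ((2 * K : ℕ) : ℚ) = 2 * K by push_cast; ring]
      linarith
    have h1 := hub _ (by positivity) ha1
    have h2 := hub _ (by positivity) hy1
    have hc' := (Rat.cast_le (K := ℝ)).2 hc
    push_cast at hc' h1 h2 ⊢
    linarith

/-- **Inscribed staircase from a table.** Given a rational lower bound `lb` of `cos (2π·)` on
`[0, 1/2] ∩ ℚ` and box offsets `t_j/Q ≤ 1/2` on `2K` uniform rows whose row inequalities hold for `lb`
(rows with `t_j = 0` are whole rows), `S/(QK) ≤ N(-2m)` where `S = Σ_j t_j`. [folklore] -/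
theorem le_volume_real_sublevelCell_of_table {lb : ℚ → ℚ}
    (hlb : ∀ x : ℚ, 0 ≤ x → x ≤ 1 / 2 → ((lb x : ℚ) : ℝ) ≤ Real.cos (2 * Real.pi * x))
    {K Q : ℕ} (hK : 0 < K) (hQ : 0 < Q) {m : ℚ} {E : ℝ} (hE : (-2 : ℝ) * m = E) (t : ℕ → ℕ) {S : ℕ}
    (hS : ∑ j ∈ range (2 * K), t j = S)
    (ht : ∀ j < 2 * K, 2 * t j ≤ Q ∧ (t j = 0 ∨
      m ≤ lb ((t j : ℚ) / Q) + lb (((min (j + 1) (2 * K - j) : ℕ) : ℚ) / (2 * K : ℕ)))) :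
    (S : ℝ) / (Q * K) ≤
      volume.real {v : Fin 2 → ℝ | (∀ i, v i ∈ Set.Ico (0 : ℝ) 1) ∧
        -2 * ∑ i : Fin 2, Real.cos (2 * Real.pi * v i) ≤ E} := by
  subst hE hS
  have hKr : (0 : ℝ) < K := by exact_mod_cast hK
  have hQr : (0 : ℝ) < Q := by exact_mod_cast hQ
  have hQq : (0 : ℚ) < Q := by exact_mod_cast hQ
  have hb1q : ∀ j < 2 * K, (t j : ℚ) / Q ≤ 1 / 2 := by
    intro j hj
    rw [div_le_iff₀ hQq]
    have : ((2 * t j : ℕ) : ℚ) ≤ Q := by exact_mod_cast (ht j hj).1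
    push_cast at this
    linarith
  have hb1 : ∀ j < 2 * K, (t j : ℝ) / Q ≤ 1 / 2 := by
    intro j hj
    have := (Rat.cast_le (K := ℝ)).2 (hb1q j hj)
    push_cast at this
    exact this
  have h := stairs_le_volume_real_sublevelCell hK (m := (m : ℝ)) (fun j => (t j : ℝ) / Q) hb1 ?_
  · refine le_trans (le_of_eq ?_) h
    have e : ∀ j : ℕ, (1 - 2 * ((t j : ℝ) / Q)) / (2 * K) = 1 / (2 * K) - (t j : ℝ) * (1 / (Q * K)) := by
      intro j; field_simp
    simp_rw [e, Finset.sum_sub_distrib, Finset.sum_const, Finset.card_range, ← Finset.sum_mul,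
      nsmul_eq_mul]
    push_cast
    field_simp
    ring
  · intro j hj
    obtain ⟨-, h0 | hc⟩ := ht j hj
    · exact Or.inl (by simp [h0])
    refine Or.inr ?_
    have hiK : ((min (j + 1) (2 * K - j) : ℕ) : ℚ) ≤ K := by
      exact_mod_cast (by omega : min (j + 1) (2 * K - j) ≤ K)
    have hy1 : ((min (j + 1) (2 * K - j) : ℕ) : ℚ) / ((2 * K : ℕ) : ℚ) ≤ 1 / 2 := by
      rw [div_le_iff₀ (by positivity), show ((2 * K : ℕ) : ℚ) = 2 * K by push_cast; ring]
      linarith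
    have h1 := hlb _ (by positivity) (hb1q j hj)
    have h2 := hlb _ (by positivity) hy1
    have hc' := (Rat.cast_le (K := ℝ)).2 hc
    push_cast at hc' h1 h2 ⊢
    linarith

/-! ### The two tables and the certified bounds at the window ends -/

/-- **`N(-79/100) ≤ 105438/300000 (= 0.35146)`**: circumscribed staircase of `60` rows for `m = 79/200`
with the box widths below (units `10⁻⁴`, folded by `j ↦ 59 - j`); the `60` row inequalities and the sum are
checked by the kernel in exact rational arithmetic. [folklore] -/
theorem volume_real_sublevelCell_windowHi_le :
    volume.real {v : Fin 2 → ℝ | (∀ i, v i ∈ Set.Ico (0 : ℝ) 1) ∧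
        -2 * ∑ i : Fin 2, Real.cos (2 * Real.pi * v i) ≤ -(79 : ℝ) / 100} ≤ 105438 / 300000 := by
  have h := volume_real_sublevelCell_le_of_table cos_two_pi_mul_le_ratPoly (K := 30) (Q := 10000)
    (m := 79 / 200) (E := -(79 : ℝ) / 100) (S := 105438) (by norm_num) (by norm_num)
    (by push_cast; norm_num)
    (fun j : ℕ => [3535, 3524, 3491, 3439, 3368, 3281, 3180, 3066, 2942, 2809, 2668, 2519, 2363,
      2201, 2031, 1854, 1668, 1471, 1257, 1020, 736, 296, 0, 0, 0, 0, 0, 0, 0, 0].getD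
        (min j (59 - j)) 0)
    (by decide +kernel) (by decide +kernel)
  refine h.trans (le_of_eq ?_)
  norm_num

/-- **`119784/300000 (= 0.39928) ≤ N(-9/25)`**: inscribed staircase of `60` rows for `m = 9/50` with the
box offsets below (units `10⁻⁴`, folded by `j ↦ 59 - j`), checked by the kernel. [folklore] -/
theorem le_volume_real_sublevelCell_windowLo :
    (119784 : ℝ) / 300000 ≤ volume.real {v : Fin 2 → ℝ | (∀ i, v i ∈ Set.Ico (0 : ℝ) 1) ∧
        -2 * ∑ i : Fin 2, Real.cos (2 * Real.pi * v i) ≤ -(9 : ℝ) / 25} := by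
  have h := le_volume_real_sublevelCell_of_table ratPoly_le_cos_two_pi_mul (K := 30) (Q := 10000)
    (m := 9 / 50) (E := -(9 : ℝ) / 25) (S := 119784) (by norm_num) (by norm_num)
    (by push_cast; norm_num)
    (fun j : ℕ => [4015, 3970, 3901, 3810, 3703, 3582, 3452, 3313, 3168, 3018, 2864, 2705, 2544,
      2379, 2211, 2040, 1865, 1686, 1502, 1309, 1106, 885, 628, 236, 0, 0, 0, 0, 0, 0].getD
        (min j (59 - j)) 0)
    (by decide +kernel) (by decide +kernel)
  refine le_trans (le_of_eq ?_) h
  norm_num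

/-! ### The stub: free level counts at the two ends of the window -/

/-- Stub (D1b) of the line `ladder-scale-certified-chain` — **free level counts at the two ends of the
window.** For all large `L`, `2·#{k ∈ (ℤ/Lℤ)² : ε_L(k) ≤ -9/25} ≥ 0.79·L²` and
`2·#{k : ε_L(k) ≤ -79/100} ≤ 0.71·L²`. Weyl law (`tendsto_torusLevelCount_div_sq`) and the certified
values `N(-9/25) ≥ 0.39928 > 0.395`, `N(-79/100) ≤ 0.35146 < 0.355`. [folklore] -/
theorem stub_freeLevelCountsWindow :
    ∃ L₁ : ℕ, ∀ L : ℕ, L₁ ≤ L → ∀ [NeZero L],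
      (79 / 100 : ℝ) * (L : ℝ) ^ 2 ≤ 2 * (torusLevelCount L (-(9:ℝ) / 25) : ℝ) ∧
      2 * (torusLevelCount L (-(79:ℝ) / 100) : ℝ) ≤ (71 / 100 : ℝ) * (L : ℝ) ^ 2 := by
  have hlo : (79 / 200 : ℝ) < volume.real {v : Fin 2 → ℝ | (∀ i, v i ∈ Set.Ico (0 : ℝ) 1) ∧
      -2 * ∑ i : Fin 2, Real.cos (2 * Real.pi * v i) ≤ -(9 : ℝ) / 25} :=
    lt_of_lt_of_le (by norm_num) le_volume_real_sublevelCell_windowLo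
  have hhi : volume.real {v : Fin 2 → ℝ | (∀ i, v i ∈ Set.Ico (0 : ℝ) 1) ∧
      -2 * ∑ i : Fin 2, Real.cos (2 * Real.pi * v i) ≤ -(79 : ℝ) / 100} < 71 / 200 :=
    lt_of_le_of_lt volume_real_sublevelCell_windowHi_le (by norm_num)
  have h1 := (tendsto_torusLevelCount_div_sq (-(9 : ℝ) / 25)).eventually (lt_mem_nhds hlo)
  have h2 := (tendsto_torusLevelCount_div_sq (-(79 : ℝ) / 100)).eventually (gt_mem_nhds hhi)
  obtain ⟨N, hN⟩ := Filter.eventually_atTop.1 (h1.and h2)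
  refine ⟨N + 1, fun L hL _ => ?_⟩
  obtain ⟨n, rfl⟩ := Nat.exists_eq_add_one_of_ne_zero (n := L) (by omega)
  obtain ⟨h1n, h2n⟩ := hN n (by omega)
  have hpos : (0 : ℝ) < ((n + 1 : ℕ) : ℝ) ^ 2 := by positivity
  rw [lt_div_iff₀ hpos] at h1n
  rw [div_lt_iff₀ hpos] at h2n
  constructor
  · linarith
  · linarith

end Summit.HubbardSuperconductivity.HubbardSuperconductivity.Theorems

end
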